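import Summits.ResolutionOfSingularities.ResolutionOfSingularities.Theorems.FrameStep2
import Literature.AlgebraicGeometry.Resolution.QuadraticTransforms

/-!
# KCarrier — the local ring `(B ⊗_k K)_𝔴` realised inside the ambient field (Layer C carriers of the tower dictionary)

0-weight TOOL toward `TightDefectClasses.TowerDictionary` (decomp-res lens-5, g39; plan `NEXT-g40.md` §6, carriers `B̃_i ⊆ L′`).
Pure commutative algebra.  Given an INJECTIVE ring map `μ : E → L` into a field (in the dictionary `E = B_i ⊗_k K`, `μ` the multiplication map, injective by
`KThread.productMap_injective` + `LinDisjoint`) and a prime `W ⊆ E` (the `K`-point `KChain.pointIdeal`), the subring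

  `carrier μ hμ W = { μ y / μ z : z ∉ W } ⊆ L`

is the localisation `E_W` (`isLocalization`: `IsLocalization.AtPrime` for the algebra `toCarrier`), hence local (`isLocalRing`); its maximal ideal and units
are read in `L` (`mem_maxSet_iff`, `mem_unitSet_carrier_iff`, in the `FrameStep.maxSet` / `unitSet` currency of `frame_step`); a `K'`-RATIONALITY of `W`
(`E/W` consists of classes of constants, `KChain.exists_one_tmul_mk_eq`) gives the hypothesis `hrat` of `frame_step` (`exists_sub_mem_maxSet`); and along a ring map
`g : E → E'` compatible with `μ, μ'` and with `W = g⁻¹ W'` (`KChain.comap_map_pointIdeal`) the carriers form a DOMINATED chain (`carrier_le`, `maxSet_subset`,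
`subringDominates`).  All PROVED, 0 sorry.  [cite: ZariskiSamuel1958, Ch. IV §11] (rings of quotients inside a field); [cite: Matsumura1987, §4].
-/

noncomputable section

set_option linter.dupNamespace false

namespace Summit.ResolutionOfSingularities.ResolutionOfSingularities.Theorems.KCarrier

open IsLocalRing
open Literature.AlgebraicGeometry.Resolution
open Summit.ResolutionOfSingularities.ResolutionOfSingularities.Theorems.FrameStep

variable {E L : Type} [CommRing E] [Field L] (μ : E →+* L) (hμ : Function.Injective μ) (W : Ideal E) [hW : W.IsPrime]

/-! ## §1 The carrier subring -/

/-- `1 ∉ W` for the prime `W`. -/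
theorem one_not_mem : (1 : E) ∉ W := (Ideal.ne_top_iff_one W).mp hW.ne_top

omit hW in
include hμ in
/-- `μ z ≠ 0` for `z ∉ W` (indeed for `z ≠ 0`). -/
theorem map_ne_zero_of_not_mem {z : E} (hz : z ∉ W) : μ z ≠ 0 := by
  intro h
  apply hz
  have hz0 : z = 0 := hμ (h.trans (map_zero μ).symm)
  rw [hz0]
  exact W.zero_mem

/-- The complement of the prime `W` is multiplicatively closed. -/
theorem mul_not_mem {z z' : E} (hz : z ∉ W) (hz' : z' ∉ W) : z * z' ∉ W :=
  fun h => (hW.mem_or_mem h).elim hz hz'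

/-- **The carrier** `E_W = { μ y / μ z : z ∉ W } ⊆ L`.  DEFINITION (support, data). -/
def carrier : Subring L where
  carrier := {x | ∃ y z : E, z ∉ W ∧ x = μ y / μ z}
  mul_mem' := by
    rintro x x' ⟨y, z, hz, rfl⟩ ⟨y', z', hz', rfl⟩
    exact ⟨y * y', z * z', mul_not_mem W hz hz', by rw [map_mul, map_mul, div_mul_div_comm]⟩
  one_mem' := ⟨1, 1, one_not_mem W, by rw [map_one, div_one]⟩
  add_mem' := by
    rintro x x' ⟨y, z, hz, rfl⟩ ⟨y', z', hz', rfl⟩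
    refine ⟨y * z' + z * y', z * z', mul_not_mem W hz hz', ?_⟩
    rw [div_add_div _ _ (map_ne_zero_of_not_mem μ hμ W hz) (map_ne_zero_of_not_mem μ hμ W hz'), map_add, map_mul, map_mul, map_mul]
  zero_mem' := ⟨0, 1, one_not_mem W, by rw [map_zero, zero_div]⟩
  neg_mem' := by
    rintro x ⟨y, z, hz, rfl⟩
    exact ⟨-y, z, hz, by rw [map_neg, neg_div]⟩

/-- Membership in the carrier subring `E_W ⊆ L`: fractions `μ y / μ z` with `z ∉ W` (definitional). -/
theorem mem_carrier_iff {x : L} : x ∈ carrier μ hμ W ↔ ∃ y z : E, z ∉ W ∧ x = μ y / μ z := Iff.rfl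

/-- `μ(E) ⊆ E_W`. -/
theorem map_mem_carrier (y : E) : μ y ∈ carrier μ hμ W := ⟨y, 1, one_not_mem W, by rw [map_one, div_one]⟩

/-- `(μ z)⁻¹ ∈ E_W` for `z ∉ W`. -/
theorem inv_map_mem_carrier {z : E} (hz : z ∉ W) : (μ z)⁻¹ ∈ carrier μ hμ W := ⟨1, z, hz, by rw [map_one, one_div]⟩

/-- **The structure map** `E → E_W`.  DEFINITION (support, data). -/
def toCarrier : E →+* carrier μ hμ W where
  toFun y := ⟨μ y, map_mem_carrier μ hμ W y⟩
  map_one' := Subtype.ext (map_one μ)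
  map_mul' y y' := Subtype.ext (map_mul μ y y')
  map_zero' := Subtype.ext (map_zero μ)
  map_add' y y' := Subtype.ext (map_add μ y y')

/-- The structure map `E → E_W` on underlying elements of `L` is `μ` (definitional). -/
@[simp] theorem coe_toCarrier (y : E) : ((toCarrier μ hμ W y : carrier μ hμ W) : L) = μ y := rfl

/-- The structure map `E → E_W` is injective (as `μ` is). -/
theorem toCarrier_injective : Function.Injective (toCarrier μ hμ W) :=
  fun y y' h => hμ (by simpa using congrArg Subtype.val h)

/-! ## §2 `E_W` is the localisation of `E` at `W`; it is local -/

/-- **`E_W` is `IsLocalization.AtPrime`** for the structure map `toCarrier` (exactness from the injectivity of `μ`). [cite: ZariskiSamuel1958, Ch. IV §11] -/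
theorem isLocalization : letI := (toCarrier μ hμ W).toAlgebra; IsLocalization.AtPrime (carrier μ hμ W) W := by
  letI := (toCarrier μ hμ W).toAlgebra
  refine ⟨?_, ?_, ?_⟩
  · rintro ⟨z, hz⟩
    refine IsUnit.of_mul_eq_one ⟨(μ z)⁻¹, inv_map_mem_carrier μ hμ W hz⟩ (Subtype.ext ?_)
    change μ z * (μ z)⁻¹ = 1
    exact mul_inv_cancel₀ (map_ne_zero_of_not_mem μ hμ W hz)
  · rintro ⟨x, y, z, hz, rfl⟩
    refine ⟨(y, ⟨z, hz⟩), Subtype.ext ?_⟩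
    change μ y / μ z * μ z = μ y
    exact div_mul_cancel₀ _ (map_ne_zero_of_not_mem μ hμ W hz)
  · intro y y' h
    refine ⟨1, ?_⟩
    have hh : μ y = μ y' := congrArg Subtype.val h
    rw [hμ hh]

/-- **`E_W` is local.** -/
theorem isLocalRing : IsLocalRing (carrier μ hμ W) := by
  letI := (toCarrier μ hμ W).toAlgebra
  haveI := isLocalization μ hμ W
  exact IsLocalization.AtPrime.isLocalRing (carrier μ hμ W) W

/-- The structure map sends `W` into the maximal ideal and its complement to units. -/
theorem toCarrier_mem_maximalIdeal_iff (y : E) :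
    haveI := isLocalRing μ hμ W; toCarrier μ hμ W y ∈ maximalIdeal (carrier μ hμ W) ↔ y ∈ W := by
  letI := (toCarrier μ hμ W).toAlgebra
  haveI := isLocalization μ hμ W
  haveI := isLocalRing μ hμ W
  exact IsLocalization.AtPrime.to_map_mem_maximal_iff (carrier μ hμ W) W y

/-- A fraction `μ y / μ z` (`z ∉ W`) is a unit of `E_W` iff `y ∉ W`. -/
theorem isUnit_div_iff {y z : E} (hz : z ∉ W) :
    IsUnit (⟨μ y / μ z, y, z, hz, rfl⟩ : carrier μ hμ W) ↔ y ∉ W := by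
  haveI := isLocalRing μ hμ W
  have hzU : IsUnit (⟨(μ z)⁻¹, inv_map_mem_carrier μ hμ W hz⟩ : carrier μ hμ W) :=
    IsUnit.of_mul_eq_one (toCarrier μ hμ W z) (Subtype.ext (by
      change (μ z)⁻¹ * μ z = 1
      exact inv_mul_cancel₀ (map_ne_zero_of_not_mem μ hμ W hz)))
  have heq : (⟨μ y / μ z, y, z, hz, rfl⟩ : carrier μ hμ W) = toCarrier μ hμ W y * ⟨(μ z)⁻¹, inv_map_mem_carrier μ hμ W hz⟩ :=
    Subtype.ext (by change μ y / μ z = μ y * (μ z)⁻¹; rw [div_eq_mul_inv])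
  have h := toCarrier_mem_maximalIdeal_iff μ hμ W y
  rw [mem_maximalIdeal, mem_nonunits_iff] at h
  rw [heq, IsUnit.mul_iff, and_iff_left hzU, ← not_iff_not, h, not_not]

/-- **The maximal ideal read in `L`**: `x ∈ 𝔪_{E_W}` iff `x = μ y / μ z` with `y ∈ W`, `z ∉ W`. -/
theorem mem_maxSet_iff {x : L} :
    haveI := isLocalRing μ hμ W; x ∈ maxSet (carrier μ hμ W) ↔ ∃ y ∈ W, ∃ z ∉ W, x = μ y / μ z := by
  haveI := isLocalRing μ hμ W
  constructor
  · rintro ⟨⟨y, z, hz, rfl⟩, hm⟩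
    refine ⟨y, ?_, z, hz, rfl⟩
    by_contra hy
    exact (mem_maximalIdeal _ |>.mp hm) ((isUnit_div_iff μ hμ W hz).mpr hy)
  · rintro ⟨y, hy, z, hz, rfl⟩
    refine ⟨⟨y, z, hz, rfl⟩, ?_⟩
    rw [mem_maximalIdeal, mem_nonunits_iff, isUnit_div_iff μ hμ W hz, not_not]
    exact hy

/-- **The units read in `L`**: `x` is a unit of `E_W` iff `x = μ y / μ z` with `y, z ∉ W`. -/
theorem mem_unitSet_carrier_iff {x : L} : x ∈ unitSet (carrier μ hμ W) ↔ ∃ y ∉ W, ∃ z ∉ W, x = μ y / μ z := by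
  constructor
  · rintro ⟨⟨y, z, hz, rfl⟩, hu⟩
    exact ⟨y, (isUnit_div_iff μ hμ W hz).mp hu, z, hz, rfl⟩
  · rintro ⟨y, hy, z, hz, rfl⟩
    exact ⟨⟨y, z, hz, rfl⟩, (isUnit_div_iff μ hμ W hz).mpr hy⟩

/-- `μ y ∈ 𝔪_{E_W}` for `y ∈ W`. -/
theorem map_mem_maxSet {y : E} (hy : y ∈ W) : haveI := isLocalRing μ hμ W; μ y ∈ maxSet (carrier μ hμ W) :=
  (mem_maxSet_iff μ hμ W).mpr ⟨y, hy, 1, one_not_mem W, by rw [map_one, div_one]⟩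

/-- `μ z` is a unit of `E_W` for `z ∉ W`. -/
theorem map_mem_unitSet {z : E} (hz : z ∉ W) : μ z ∈ unitSet (carrier μ hμ W) :=
  (mem_unitSet_carrier_iff μ hμ W).mpr ⟨z, hz, 1, one_not_mem W, by rw [map_one, div_one]⟩

/-! ## §3 Rationality: `hrat` of `frame_step` from the `K'`-rationality of `W` -/

/-- **`hrat`.**  If `W` is `K'`-rational for constants `ι : K' → E` (every class of `E/W` is the class of a constant — `KChain.exists_one_tmul_mk_eq`), then every
element of `E_W` is a constant modulo `𝔪_{E_W}` — the hypothesis `hrat` of `FrameStep.frame_step` (with `algebraMap K L = μ ∘ ι`). -/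
theorem exists_sub_mem_maxSet [W.IsMaximal] {K' : Type} [CommRing K'] (ι : K' →+* E)
    (hrat : ∀ Y : E ⧸ W, ∃ a : K', Ideal.Quotient.mk W (ι a) = Y) (w : L) (hw : w ∈ carrier μ hμ W) :
    haveI := isLocalRing μ hμ W; ∃ a : K', w - μ (ι a) ∈ maxSet (carrier μ hμ W) := by
  haveI := isLocalRing μ hμ W
  obtain ⟨y, z, hz, rfl⟩ := hw
  -- `z` is invertible modulo the maximal ideal `W`: `z z' + c = 1`, `c ∈ W`
  obtain ⟨z', c, hc, hzc⟩ := (‹W.IsMaximal›).exists_inv hz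
  obtain ⟨a, ha⟩ := hrat (Ideal.Quotient.mk W (y * z'))
  refine ⟨a, (mem_maxSet_iff μ hμ W).mpr ⟨y - ι a * z, ?_, z, hz, ?_⟩⟩
  · have h1 : ι a * z - y * z' * z ∈ W := by
      have h0 : ι a - y * z' ∈ W := by rw [← Ideal.Quotient.eq]; exact ha
      have := W.mul_mem_right z h0
      rwa [sub_mul] at this
    have hc' : c = 1 - z * z' := by rw [← hzc]; ring
    have key : y - ι a * z = y * c - (ι a * z - y * z' * z) := by rw [hc']; ring
    rw [key]
    exact W.sub_mem (W.mul_mem_left y hc) h1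
  · rw [map_sub, map_mul, sub_div, mul_div_assoc, div_self (map_ne_zero_of_not_mem μ hμ W hz), mul_one]

/-! ## §4 Domination along the tower -/

section Chain

variable {E' : Type} [CommRing E'] (μ' : E' →+* L) (hμ' : Function.Injective μ') (W' : Ideal E') [hW' : W'.IsPrime]
  (g : E →+* E') (hg : μ'.comp g = μ) (hWW : W'.comap g = W)

include hg hWW in
/-- **Monotonicity**: `E_W ⊆ E'_{W'}` when `μ' ∘ g = μ` and `g⁻¹ W' = W`. -/
theorem carrier_le : carrier μ hμ W ≤ carrier μ' hμ' W' := by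
  rintro x ⟨y, z, hz, rfl⟩
  refine ⟨g y, g z, ?_, ?_⟩
  · rwa [← Ideal.mem_comap, hWW]
  · rw [← hg]
    rfl

include hg hWW in
/-- **Domination (maximal ideals)**: `𝔪_{E_W} ⊆ 𝔪_{E'_{W'}}`. -/
theorem maxSet_subset :
    haveI := isLocalRing μ hμ W; haveI := isLocalRing μ' hμ' W'; maxSet (carrier μ hμ W) ⊆ maxSet (carrier μ' hμ' W') := by
  intro x hx
  obtain ⟨y, hy, z, hz, rfl⟩ := (mem_maxSet_iff μ hμ W).mp hx
  refine (mem_maxSet_iff μ' hμ' W').mpr ⟨g y, ?_, g z, ?_, ?_⟩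
  · rw [← Ideal.mem_comap, hWW]; exact hy
  · rw [← Ideal.mem_comap, hWW]; exact hz
  · rw [← hg]; rfl

include hg hWW in
/-- **Domination (units)**: units of `E_W` are units of `E'_{W'}`. -/
theorem unitSet_subset : unitSet (carrier μ hμ W) ⊆ unitSet (carrier μ' hμ' W') := by
  intro x hx
  obtain ⟨y, hy, z, hz, rfl⟩ := (mem_unitSet_carrier_iff μ hμ W).mp hx
  refine (mem_unitSet_carrier_iff μ' hμ' W').mpr ⟨g y, ?_, g z, ?_, ?_⟩
  · rw [← Ideal.mem_comap, hWW]; exact hy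
  · rw [← Ideal.mem_comap, hWW]; exact hz
  · rw [← hg]; rfl

include hg hWW in
/-- **Domination in the tree currency** `SubringDominates E_W E'_{W'}`. -/
theorem subringDominates : SubringDominates (carrier μ hμ W) (carrier μ' hμ' W') := by
  refine ⟨carrier_le μ hμ W μ' hμ' W' g hg hWW, fun x hx hinv => ?_⟩
  obtain ⟨y, z, hz, rfl⟩ := hx
  by_cases hy : y ∈ W
  · -- then `x ∈ 𝔪_{E'_{W'}}` is not a unit there: `x⁻¹ ∈ E'_{W'}` forces `x = 0`
    haveI := isLocalRing μ' hμ' W'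
    have hxm : μ y / μ z ∈ maxSet (carrier μ' hμ' W') :=
      maxSet_subset μ hμ W μ' hμ' W' g hg hWW (by haveI := isLocalRing μ hμ W; exact (mem_maxSet_iff μ hμ W).mpr ⟨y, hy, z, hz, rfl⟩)
    by_cases hx0 : μ y / μ z = 0
    · rw [hx0, inv_zero]
      exact Subring.zero_mem _
    · exact absurd (mem_unitSet_iff.mpr ⟨carrier_le μ hμ W μ' hμ' W' g hg hWW ⟨y, z, hz, rfl⟩, hinv, hx0⟩) (fun hu => not_mem_maxSet_of_mem_unitSet hu hxm)
  · exact ⟨z, y, hy, by rw [inv_div]⟩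

end Chain

end Summit.ResolutionOfSingularities.ResolutionOfSingularities.Theorems.KCarrier
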